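import Summits.NavierStokesRegularity.NavierStokesRegularity.Theorems.PerpetualPumpAveragedTypeIBlowupTrailPairTools
import Mathlib.Topology.Order.Lattice

/-!
# Crux `PerpetualPump.AveragedTypeIBlowup` (stmt-NavierStokesRegularity-1835), line `Sketch`:
# stub `trailPair` — the quiet trail of a spent carrier/bond pair

This file proves the registered stub `stub_trailPair` (G9, Mathlib-only) of the line skeleton
`Cruxes/AveragedTypeIBlowup/Lines/Sketch.lean`. Data: a spent carrier/bond pair `(bk, wk)` of the
seeded graded Toda circuit in its own slow time `τ`,
`bk' = -bk - wk² + wl² - ε̄ bk wk + e₀`, `wk' = wk (bk - br - 1) + ε̄ bk² + e₁`,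
with memory errors `|eᵢ| ≤ η mᵢ` controlled by Duhamel majorants
`mᵢ(τ) ≤ mᵢ(0) e^{-θτ} + ∫₀^τ e^{-θ(τ-u)} |Gᵢ(u)| du` of the nonlinear brackets
`G₀ = -wk² + wl² - ε̄ bk wk`, `G₁ = wk (bk - br) + ε̄ bk²`, a spent bond `|wl| ≤ ω` below and a
residual carrier `br ∈ [-9/20, 9/10]` above. Conclusion: for all later time the pair stays in its
box, `bk ∈ [-9/20, 7/20]`, `|bk - bk(0)e^{-τ}| ≤ 1/20`, `|wk| ≤ ω`, and the majorants relax to the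
floors `3ω²/θ`, `3ω/θ`.

Proof (a bootstrap, Mathlib only; tools in `…TrailPairTools.lean`).
* `trailPair_core` — under the a-priori bounds `|wk| ≤ ω`, `|bk| ≤ 1/2` on `[0, T]` (and a loose
  neighbour box `|wl| ≤ Lω`, `0 ≤ L ≤ 2`, `br ∈ [-1/2, 9/10]`): `|G₀| ≤ (L²+2)ω²`, `|G₁| ≤ 3ω/2`,
  so `m₀ ≤ μe^{-θτ} + (L²+2)ω²/θ`, `m₁ ≤ μe^{-θτ} + 3ω/(2θ)` (kernel mass `≤ 1/θ`); the carrier obeys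
  `|bk' + bk| ≤ A + ημ e^{-θτ}` with `A = (L²+2)ω²(1 + η/θ) ≤ 7·10⁻⁴`, whence (supersolution
  `A + ημ τ e^{-θτ}`, `τe^{-θτ} ≤ 3/(8θ)`, `ημ ≤ θ/10`) `|bk - bk(0)e^{-τ}| ≤ 1/20` and
  `bk ∈ [-9/20, 7/20]`; then the bond rate is `bk - br - 1 ≤ -3/20` and the forcing is
  `≤ (81/400)ε̄ + η m₁`, whence (supersolution `a/ρ + (ω/2 + ημτ)e^{-ρτ}`, `ρ = 3/20`)
  `|wk| ≤ (0.135 + 0.1 + 0.5 + 0.209) ω ≤ (19/20) ω`.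
* `trailPair_general` — the a-priori bounds hold at `τ = 0` and are strictly improved by
  `trailPair_core` on any initial segment where they hold, so they hold on `[0, T]` by continuous
  induction; the conclusions follow.
* `stub_trailPair` — the registered signature, `L = 1`.

## References

* T. Tao, *Finite time blowup for an averaged three-dimensional Navier–Stokes equation*, J. Amer.
  Math. Soc. 29 (2016), 601–674, §5–6 (the trail bookkeeping is a folklore ODE bootstrap).
-/

noncomputable section

-- the summit namespace `…NavierStokesRegularity.NavierStokesRegularity…` is the tree convention
set_option linter.dupNamespace false

open MeasureTheory Set Filter Topology

namespace Summit.NavierStokesRegularity.NavierStokesRegularity.Theorems.PerpetualPumpAveragedTypeIBlowup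

/-- **The trail estimates under the bootstrap hypothesis.** If, in addition to the hypotheses of
the quiet-trail stub (with a loose neighbour box `|wl| ≤ L ω`, `0 ≤ L ≤ 2`, `br ∈ [-1/2, 9/10]`),
the a-priori bounds `|wk| ≤ ω`, `|bk| ≤ 1/2` hold on `[0, T]`, then on `[0, T]`: the brackets obey
`|G₀| ≤ (L² + 2) ω²`, `|G₁| ≤ 3ω/2`, so the majorants obey `m₀ ≤ μe^{-θτ} + (L²+2)ω²/θ`,
`m₁ ≤ μe^{-θτ} + 3ω/(2θ)`; the carrier satisfies `|bk - bk(0)e^{-τ}| ≤ 1/20` (hence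
`bk ∈ [-9/20, 7/20]`, strictly inside `|bk| ≤ 1/2`); the bond rate is `≤ -3/20` and
`|wk| ≤ (19/20) ω` (strictly inside `|wk| ≤ ω`). [folklore] -/
theorem trailPair_core {bk wk m0 m1 wl br e0 e1 : ℝ → ℝ} {θ η εb ω μ T L : ℝ}
    (hL0 : 0 ≤ L) (hL2 : L ≤ 2) (hθ : 1 / 2 ≤ θ) (hθ1 : θ ≤ 1) (hη : 0 ≤ η) (hεb : 0 < εb)
    (hεω : 10 * εb ≤ ω) (hω1 : ω ≤ 1 / 100) (hμ : 0 ≤ μ) (hημω : η * μ ≤ ω / 12)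
    (hηθ : η ≤ θ / 100) (hT : 0 ≤ T)
    (hbk : ContinuousOn bk (Icc 0 T)) (hwk : ContinuousOn wk (Icc 0 T))
    (hwl : ContinuousOn wl (Icc 0 T)) (hbr : ContinuousOn br (Icc 0 T))
    (hdb : ∀ τ ∈ Ioo 0 T,
      HasDerivAt bk (-(bk τ) - (wk τ) ^ 2 + (wl τ) ^ 2 - εb * bk τ * wk τ + e0 τ) τ)
    (hdw : ∀ τ ∈ Ioo 0 T, HasDerivAt wk (wk τ * (bk τ - br τ - 1) + εb * (bk τ) ^ 2 + e1 τ) τ)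
    (he0 : ∀ τ ∈ Icc 0 T, |e0 τ| ≤ η * m0 τ) (he1 : ∀ τ ∈ Icc 0 T, |e1 τ| ≤ η * m1 τ)
    (hm0 : ∀ τ ∈ Icc 0 T, 0 ≤ m0 τ ∧ m0 τ ≤ m0 0 * Real.exp (-(θ * τ)) +
      ∫ u in (0 : ℝ)..τ, Real.exp (-(θ * (τ - u))) * |-(wk u) ^ 2 + (wl u) ^ 2 - εb * bk u * wk u|)
    (hm1 : ∀ τ ∈ Icc 0 T, 0 ≤ m1 τ ∧ m1 τ ≤ m1 0 * Real.exp (-(θ * τ)) +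
      ∫ u in (0 : ℝ)..τ, Real.exp (-(θ * (τ - u))) * |wk u * (bk u - br u) + εb * (bk u) ^ 2|)
    (hwlω : ∀ τ ∈ Icc 0 T, |wl τ| ≤ L * ω)
    (hbrI : ∀ τ ∈ Icc 0 T, -(1 / 2) ≤ br τ ∧ br τ ≤ 9 / 10)
    (hb0l : -(2 / 5) ≤ bk 0) (hb0u : bk 0 ≤ 3 / 10) (hw0 : |wk 0| ≤ ω / 2) (hm00 : m0 0 ≤ μ)
    (hm10 : m1 0 ≤ μ) (hQ : ∀ τ ∈ Icc 0 T, |wk τ| ≤ ω ∧ |bk τ| ≤ 1 / 2) :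
    ∀ τ ∈ Icc 0 T, -(9 / 20) ≤ bk τ ∧ bk τ ≤ 7 / 20 ∧ |wk τ| ≤ 19 / 20 * ω ∧
      |bk τ - bk 0 * Real.exp (-τ)| ≤ 1 / 20 ∧
      m0 τ ≤ μ * Real.exp (-(θ * τ)) + (L ^ 2 + 2) * ω ^ 2 / θ ∧
      m1 τ ≤ μ * Real.exp (-(θ * τ)) + 3 / 2 * ω / θ := by
  have hθpos : 0 < θ := by linarith
  have hω : 0 < ω := by linarith
  have hεω' : εb ≤ ω / 10 := by linarith
  have hηθ' : η / θ ≤ 1 / 100 := by rw [div_le_iff₀ hθpos]; linarith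
  have hημθ' : η * μ / θ ≤ 1 / 10 := by rw [div_le_iff₀ hθpos]; linarith
  have hω2 : ω ^ 2 ≤ (1 / 100) ^ 2 := sq_le_sq' (by linarith) hω1
  norm_num at hω2
  have hL4 : L ^ 2 ≤ 2 ^ 2 := sq_le_sq' (by linarith) hL2
  norm_num at hL4
  have hC0 : 0 ≤ (L ^ 2 + 2) * ω ^ 2 := by positivity
  -- Step A: the carrier bracket and its majorant
  have hG0 : ∀ u ∈ Icc 0 T, |-(wk u) ^ 2 + (wl u) ^ 2 - εb * bk u * wk u| ≤ (L ^ 2 + 2) * ω ^ 2 := by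
    intro u hu
    obtain ⟨hw, hb⟩ := hQ u hu
    have hwl' := hwlω u hu
    have h1 : (wk u) ^ 2 ≤ ω ^ 2 := sq_le_sq' (abs_le.1 hw).1 (abs_le.1 hw).2
    have h2 : (wl u) ^ 2 ≤ (L * ω) ^ 2 := sq_le_sq' (abs_le.1 hwl').1 (abs_le.1 hwl').2
    have h3 : |bk u * wk u| ≤ 1 / 2 * ω := by
      rw [abs_mul]
      exact mul_le_mul hb hw (abs_nonneg _) (by norm_num)
    have h4 := abs_le.1 h3
    have h5 : εb * ω ≤ ω / 10 * ω := mul_le_mul_of_nonneg_right hεω' hω.le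
    have h6 : εb * (bk u * wk u) ≤ εb * (1 / 2 * ω) := mul_le_mul_of_nonneg_left h4.2 hεb.le
    have h7 : εb * -(1 / 2 * ω) ≤ εb * (bk u * wk u) := mul_le_mul_of_nonneg_left h4.1 hεb.le
    have h8 := sq_nonneg (wk u)
    have h9 := sq_nonneg (wl u)
    rw [abs_le]
    constructor <;> linarith
  have hm0b : ∀ τ ∈ Icc 0 T, m0 τ ≤ μ * Real.exp (-(θ * τ)) + (L ^ 2 + 2) * ω ^ 2 / θ := by
    intro τ hτ
    have hg : ContinuousOn (fun u => -(wk u) ^ 2 + (wl u) ^ 2 - εb * bk u * wk u) (Icc 0 τ) :=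
      (((hwk.pow 2).neg.add (hwl.pow 2)).sub
        (((continuousOn_const (c := εb)).mul hbk).mul hwk)).mono (Icc_subset_Icc_right hτ.2)
    exact trailPair_majorant_le hθpos hC0 hτ.1 hg
      (fun u hu => hG0 u ⟨hu.1, hu.2.trans hτ.2⟩) hm00 (hm0 τ hτ).2
  -- Step B: the bond bracket and its majorant
  have hG1 : ∀ u ∈ Icc 0 T, |wk u * (bk u - br u) + εb * (bk u) ^ 2| ≤ 3 / 2 * ω := by
    intro u hu
    obtain ⟨hw, hb⟩ := hQ u hu
    obtain ⟨hbr1, hbr2⟩ := hbrI u hu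
    have hb' := abs_le.1 hb
    have h1 : |bk u - br u| ≤ 7 / 5 := by
      rw [abs_le]
      constructor <;> linarith
    have h2 : |wk u * (bk u - br u)| ≤ ω * (7 / 5) := by
      rw [abs_mul]
      exact mul_le_mul hw h1 (abs_nonneg _) hω.le
    have h3 : (bk u) ^ 2 ≤ (1 / 2) ^ 2 := sq_le_sq' hb'.1 hb'.2
    norm_num at h3
    have h4 : 0 ≤ εb * (bk u) ^ 2 := by positivity
    have h5 : εb * (bk u) ^ 2 ≤ εb * (1 / 4) := mul_le_mul_of_nonneg_left h3 hεb.le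
    have h6 := abs_le.1 h2
    rw [abs_le]
    constructor <;> linarith
  have hm1b : ∀ τ ∈ Icc 0 T, m1 τ ≤ μ * Real.exp (-(θ * τ)) + 3 / 2 * ω / θ := by
    intro τ hτ
    have hg : ContinuousOn (fun u => wk u * (bk u - br u) + εb * (bk u) ^ 2) (Icc 0 τ) :=
      ((hwk.mul (hbk.sub hbr)).add
        ((continuousOn_const (c := εb)).mul (hbk.pow 2))).mono (Icc_subset_Icc_right hτ.2)
    exact trailPair_majorant_le hθpos (by linarith) hτ.1 hg
      (fun u hu => hG1 u ⟨hu.1, hu.2.trans hτ.2⟩) hm10 (hm1 τ hτ).2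
  -- Step C: the carrier relaxes
  have hA : 0 ≤ (L ^ 2 + 2) * ω ^ 2 + η * ((L ^ 2 + 2) * ω ^ 2 / θ) :=
    add_nonneg hC0 (mul_nonneg hη (div_nonneg hC0 hθpos.le))
  have hcar : ∀ τ ∈ Icc 0 T, |bk τ - bk 0 * Real.exp (-τ)| ≤
      ((L ^ 2 + 2) * ω ^ 2 + η * ((L ^ 2 + 2) * ω ^ 2 / θ)) +
        η * μ * τ * Real.exp (-(θ * τ)) := by
    refine trailPair_carrier hT hA (mul_nonneg hη hμ) hθ1 hbk fun t ht => ?_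
    have htI : t ∈ Icc 0 T := ⟨ht.1.le, ht.2.le⟩
    refine ⟨_, hdb t ht, ?_⟩
    have h1 := abs_le.1 (hG0 t htI)
    have h2 : |e0 t| ≤ η * (μ * Real.exp (-(θ * t)) + (L ^ 2 + 2) * ω ^ 2 / θ) :=
      (he0 t htI).trans (mul_le_mul_of_nonneg_left (hm0b t htI) hη)
    have h3 := abs_le.1 h2
    rw [abs_le]
    constructor <;> linarith
  have hcar' : ∀ τ ∈ Icc 0 T, |bk τ - bk 0 * Real.exp (-τ)| ≤ 1 / 20 := by
    intro τ hτ
    have h := hcar τ hτ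
    have h1 : τ * Real.exp (-(θ * τ)) ≤ 3 / (8 * θ) := trailPair_mul_exp_neg_le hθpos τ
    have h2 : η * μ * (τ * Real.exp (-(θ * τ))) ≤ η * μ * (3 / (8 * θ)) :=
      mul_le_mul_of_nonneg_left h1 (mul_nonneg hη hμ)
    have h3 : η * μ * (3 / (8 * θ)) = 3 / 8 * (η * μ / θ) := by ring
    have h4 : η * ((L ^ 2 + 2) * ω ^ 2 / θ) = (L ^ 2 + 2) * ω ^ 2 * (η / θ) := by ring
    have h5 : (L ^ 2 + 2) * ω ^ 2 * (η / θ) ≤ (L ^ 2 + 2) * ω ^ 2 * (1 / 100) :=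
      mul_le_mul_of_nonneg_left hηθ' hC0
    have h6 : (L ^ 2 + 2) * ω ^ 2 ≤ 6 * ω ^ 2 := mul_le_mul_of_nonneg_right (by linarith) (sq_nonneg ω)
    linarith
  have hbkI : ∀ τ ∈ Icc 0 T, -(9 / 20) ≤ bk τ ∧ bk τ ≤ 7 / 20 := by
    intro τ hτ
    have h := abs_le.1 (hcar' τ hτ)
    have he : Real.exp (-τ) ≤ 1 := Real.exp_le_one_iff.2 (by linarith [hτ.1])
    have he0 : 0 < Real.exp (-τ) := Real.exp_pos _
    have hu := mul_le_mul_of_nonneg_right hb0u he0.le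
    have hl := mul_le_mul_of_nonneg_right hb0l he0.le
    constructor <;> linarith
  -- Step D: the bond is damped at rate `3/20`
  have ha : 0 ≤ εb * (81 / 400) + η * (3 / 2 * ω / θ) :=
    add_nonneg (by positivity) (mul_nonneg hη (div_nonneg (by linarith) hθpos.le))
  have hbond : ∀ τ ∈ Icc 0 T, |wk τ| ≤ (εb * (81 / 400) + η * (3 / 2 * ω / θ)) / (3 / 20) +
      (ω / 2 + η * μ * τ) * Real.exp (-(3 / 20 * τ)) := by
    refine trailPair_bond (θ := θ) (r := fun u => bk u - br u - 1) hT ha (mul_nonneg hη hμ)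
      (by norm_num) (by linarith) hwk ((hbk.sub hbr).sub continuousOn_const) ?_ hw0 ?_
    · intro t ht
      have htI : t ∈ Icc 0 T := ⟨ht.1.le, ht.2.le⟩
      have h1 := (hbkI t htI).2
      have h2 := (hbrI t htI).1
      show bk t - br t - 1 ≤ -(3 / 20)
      linarith
    · intro t ht
      have htI : t ∈ Icc 0 T := ⟨ht.1.le, ht.2.le⟩
      refine ⟨_, hdw t ht, ?_⟩
      show |wk t * (bk t - br t - 1) + εb * (bk t) ^ 2 + e1 t - (bk t - br t - 1) * wk t| ≤
        εb * (81 / 400) + η * (3 / 2 * ω / θ) + η * μ * Real.exp (-(θ * t))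
      have key : wk t * (bk t - br t - 1) + εb * (bk t) ^ 2 + e1 t - (bk t - br t - 1) * wk t =
          εb * (bk t) ^ 2 + e1 t := by ring
      rw [key]
      obtain ⟨hl, hu⟩ := hbkI t htI
      have hb2 : (bk t) ^ 2 ≤ (9 / 20) ^ 2 := sq_le_sq' (by linarith) (by linarith)
      norm_num at hb2
      have h4 : 0 ≤ εb * (bk t) ^ 2 := by positivity
      have h5 : εb * (bk t) ^ 2 ≤ εb * (81 / 400) := mul_le_mul_of_nonneg_left hb2 hεb.le
      have h6 : |e1 t| ≤ η * (μ * Real.exp (-(θ * t)) + 3 / 2 * ω / θ) :=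
        (he1 t htI).trans (mul_le_mul_of_nonneg_left (hm1b t htI) hη)
      have h7 := abs_le.1 h6
      rw [abs_le]
      constructor <;> linarith
  have hbond' : ∀ τ ∈ Icc 0 T, |wk τ| ≤ 19 / 20 * ω := by
    intro τ hτ
    have h := hbond τ hτ
    have h1 : τ * Real.exp (-(3 / 20 * τ)) ≤ 3 / (8 * (3 / 20)) :=
      trailPair_mul_exp_neg_le (by norm_num) τ
    norm_num at h1
    have h2 : η * μ * (τ * Real.exp (-(3 / 20 * τ))) ≤ η * μ * (5 / 2) :=
      mul_le_mul_of_nonneg_left h1 (mul_nonneg hη hμ)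
    have he : Real.exp (-(3 / 20 * τ)) ≤ 1 := Real.exp_le_one_iff.2 (by linarith [hτ.1])
    have h3 : ω / 2 * Real.exp (-(3 / 20 * τ)) ≤ ω / 2 * 1 :=
      mul_le_mul_of_nonneg_left he (by linarith)
    have h4 : (εb * (81 / 400) + η * (3 / 2 * ω / θ)) / (3 / 20) =
        27 / 20 * εb + 10 * (ω * (η / θ)) := by ring
    have h5 : ω * (η / θ) ≤ ω * (1 / 100) := mul_le_mul_of_nonneg_left hηθ' hω.le
    rw [h4] at h
    linarith
  intro τ hτ
  exact ⟨(hbkI τ hτ).1, (hbkI τ hτ).2, hbond' τ hτ, hcar' τ hτ, hm0b τ hτ, hm1b τ hτ⟩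

/-- **The quiet trail with a loose neighbour box.** The hypotheses of `stub_trailPair`, except
that the spent bond below is only known to satisfy `|wl| ≤ L ω` (`0 ≤ L ≤ 2`) and the residual
carrier above `br ∈ [-1/2, 9/10]`, imply on all of `[0, T]`: `bk ∈ [-9/20, 7/20]`, `|wk| ≤ ω`,
`|bk - bk(0)e^{-τ}| ≤ 1/20`, `m₀ ≤ μe^{-θτ} + (L² + 2)ω²/θ`, `m₁ ≤ μe^{-θτ} + 3ω/θ`. Proof: the
a-priori bounds `|wk| ≤ ω`, `|bk| ≤ 1/2` hold at `τ = 0` and are improved strictly by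
`trailPair_core` wherever they hold on an initial segment, so they hold on `[0, T]` by continuous
induction (`trailPair_realInduction` applied to `max (|wk| - ω) (|bk| - 1/2)`). [folklore] -/
theorem trailPair_general {bk wk m0 m1 wl br e0 e1 : ℝ → ℝ} {θ η εb ω μ T L : ℝ}
    (hL0 : 0 ≤ L) (hL2 : L ≤ 2) (hθ : 1 / 2 ≤ θ) (hθ1 : θ ≤ 1) (hη : 0 ≤ η) (hεb : 0 < εb)
    (hεω : 10 * εb ≤ ω) (hω1 : ω ≤ 1 / 100) (hμ : 0 ≤ μ) (hημω : η * μ ≤ ω / 12)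
    (hηθ : η ≤ θ / 100) (hT : 0 ≤ T)
    (hbk : ContinuousOn bk (Icc 0 T)) (hwk : ContinuousOn wk (Icc 0 T))
    (hwl : ContinuousOn wl (Icc 0 T)) (hbr : ContinuousOn br (Icc 0 T))
    (hdb : ∀ τ ∈ Ioo 0 T,
      HasDerivAt bk (-(bk τ) - (wk τ) ^ 2 + (wl τ) ^ 2 - εb * bk τ * wk τ + e0 τ) τ)
    (hdw : ∀ τ ∈ Ioo 0 T, HasDerivAt wk (wk τ * (bk τ - br τ - 1) + εb * (bk τ) ^ 2 + e1 τ) τ)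
    (he0 : ∀ τ ∈ Icc 0 T, |e0 τ| ≤ η * m0 τ) (he1 : ∀ τ ∈ Icc 0 T, |e1 τ| ≤ η * m1 τ)
    (hm0 : ∀ τ ∈ Icc 0 T, 0 ≤ m0 τ ∧ m0 τ ≤ m0 0 * Real.exp (-(θ * τ)) +
      ∫ u in (0 : ℝ)..τ, Real.exp (-(θ * (τ - u))) * |-(wk u) ^ 2 + (wl u) ^ 2 - εb * bk u * wk u|)
    (hm1 : ∀ τ ∈ Icc 0 T, 0 ≤ m1 τ ∧ m1 τ ≤ m1 0 * Real.exp (-(θ * τ)) +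
      ∫ u in (0 : ℝ)..τ, Real.exp (-(θ * (τ - u))) * |wk u * (bk u - br u) + εb * (bk u) ^ 2|)
    (hwlω : ∀ τ ∈ Icc 0 T, |wl τ| ≤ L * ω)
    (hbrI : ∀ τ ∈ Icc 0 T, -(1 / 2) ≤ br τ ∧ br τ ≤ 9 / 10)
    (hb0l : -(2 / 5) ≤ bk 0) (hb0u : bk 0 ≤ 3 / 10) (hw0 : |wk 0| ≤ ω / 2) (hm00 : m0 0 ≤ μ)
    (hm10 : m1 0 ≤ μ) :
    ∀ τ ∈ Icc 0 T, -(9 / 20) ≤ bk τ ∧ bk τ ≤ 7 / 20 ∧ |wk τ| ≤ ω ∧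
      |bk τ - bk 0 * Real.exp (-τ)| ≤ 1 / 20 ∧
      m0 τ ≤ μ * Real.exp (-(θ * τ)) + (L ^ 2 + 2) * ω ^ 2 / θ ∧
      m1 τ ≤ μ * Real.exp (-(θ * τ)) + 3 * ω / θ := by
  have hθpos : 0 < θ := by linarith
  have hω : 0 < ω := by linarith
  -- the bootstrap: `|wk| ≤ ω` and `|bk| ≤ 1/2` hold on all of `[0, T]`
  have hQ : ∀ τ ∈ Icc 0 T, |wk τ| ≤ ω ∧ |bk τ| ≤ 1 / 2 := by
    have hf : ContinuousOn (fun u => max (|wk u| - ω) (|bk u| - 1 / 2)) (Icc 0 T) :=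
      ((continuous_abs.comp_continuousOn hwk).sub continuousOn_const).sup
        ((continuous_abs.comp_continuousOn hbk).sub continuousOn_const)
    have h0 : max (|wk 0| - ω) (|bk 0| - 1 / 2) ≤ 0 := by
      have : |bk 0| ≤ 1 / 2 := abs_le.2 ⟨by linarith, by linarith⟩
      exact max_le (by linarith) (by linarith)
    have hstep : ∀ τ ∈ Icc 0 T, (∀ u ∈ Icc 0 τ, max (|wk u| - ω) (|bk u| - 1 / 2) ≤ 0) →
        max (|wk τ| - ω) (|bk τ| - 1 / 2) < 0 := by
      intro τ hτ hu
      have hQτ : ∀ u ∈ Icc 0 τ, |wk u| ≤ ω ∧ |bk u| ≤ 1 / 2 := fun u hu' => by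
        have h := max_le_iff.1 (hu u hu')
        exact ⟨by linarith [h.1], by linarith [h.2]⟩
      have hsub : Icc 0 τ ⊆ Icc 0 T := Icc_subset_Icc_right hτ.2
      have hsub' : Ioo 0 τ ⊆ Ioo 0 T := Ioo_subset_Ioo_right hτ.2
      obtain ⟨h1, h2, h3, -⟩ := trailPair_core hL0 hL2 hθ hθ1 hη hεb hεω hω1 hμ hημω hηθ hτ.1
        (hbk.mono hsub) (hwk.mono hsub) (hwl.mono hsub) (hbr.mono hsub)
        (fun t ht => hdb t (hsub' ht)) (fun t ht => hdw t (hsub' ht))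
        (fun t ht => he0 t (hsub ht)) (fun t ht => he1 t (hsub ht))
        (fun t ht => hm0 t (hsub ht)) (fun t ht => hm1 t (hsub ht))
        (fun t ht => hwlω t (hsub ht)) (fun t ht => hbrI t (hsub ht))
        hb0l hb0u hw0 hm00 hm10 hQτ τ (right_mem_Icc.2 hτ.1)
      have h4 : |bk τ| ≤ 9 / 20 := abs_le.2 ⟨by linarith, by linarith⟩
      exact max_lt (by linarith) (by linarith)
    intro τ hτ
    have h := max_le_iff.1 (trailPair_realInduction hf h0 hstep τ hτ)
    exact ⟨by linarith [h.1], by linarith [h.2]⟩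
  intro τ hτ
  obtain ⟨h1, h2, h3, h4, h5, h6⟩ := trailPair_core hL0 hL2 hθ hθ1 hη hεb hεω hω1 hμ hημω hηθ hT
    hbk hwk hwl hbr hdb hdw he0 he1 hm0 hm1 hwlω hbrI hb0l hb0u hw0 hm00 hm10 hQ τ hτ
  have h7 : (3 / 2 * ω / θ) ≤ 3 * ω / θ := by
    rw [div_le_div_iff_of_pos_right hθpos]
    linarith
  exact ⟨h1, h2, by linarith, h4, h5, by linarith⟩

/-- **Registered stub `stub_trailPair`** (G9 of line `Sketch`, crux `PerpetualPump.AveragedTypeIBlowup`,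
stmt-NavierStokesRegularity-1835): THE QUIET TRAIL. A spent carrier/bond pair of the seeded Toda
circuit in its own slow time (`bk' = -bk - wk² + wl² - ε̄ bk wk + e₀`,
`wk' = wk (bk - br - 1) + ε̄ bk² + e₁`), entering with `bk ∈ [-2/5, 3/10]`, `|wk| ≤ ω/2`, memory
majorants `≤ μ` (`ημ ≤ min(θ/10, ω/12)`, `η ≤ θ/100`), between a spent bond `|wl| ≤ ω` and a
residual carrier `br ∈ [-9/20, 9/10]`, stays in its box for all later time: `bk ∈ [-9/20, 7/20]`,
`|bk - bk(0)e^{-τ}| ≤ 1/20`, `|wk| ≤ ω`, `m₀ ≤ μe^{-θτ} + 3ω²/θ`, `m₁ ≤ μe^{-θτ} + 3ω/θ`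
(`trailPair_general` with `L = 1`). [folklore] -/
theorem stub_trailPair :
    ∀ (bk wk m0 m1 wl br e0 e1 : ℝ → ℝ) (θ η εb ω μ T : ℝ),
      1 / 2 ≤ θ → θ ≤ 1 → 0 ≤ η → 0 < εb → 10 * εb ≤ ω → ω ≤ 1 / 100 → 0 ≤ μ →
      η * μ ≤ θ / 10 → η * μ ≤ ω / 12 → η ≤ θ / 100 → 0 ≤ T →
      ContinuousOn bk (Icc 0 T) → ContinuousOn wk (Icc 0 T) → ContinuousOn m0 (Icc 0 T) →
      ContinuousOn m1 (Icc 0 T) → ContinuousOn wl (Icc 0 T) → ContinuousOn br (Icc 0 T) →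
      ContinuousOn e0 (Icc 0 T) → ContinuousOn e1 (Icc 0 T) →
      (∀ τ ∈ Ioo 0 T, HasDerivAt bk (-(bk τ) - (wk τ) ^ 2 + (wl τ) ^ 2 - εb * bk τ * wk τ + e0 τ) τ) →
      (∀ τ ∈ Ioo 0 T, HasDerivAt wk (wk τ * (bk τ - br τ - 1) + εb * (bk τ) ^ 2 + e1 τ) τ) →
      (∀ τ ∈ Icc 0 T, |e0 τ| ≤ η * m0 τ) → (∀ τ ∈ Icc 0 T, |e1 τ| ≤ η * m1 τ) →
      (∀ τ ∈ Icc 0 T, 0 ≤ m0 τ ∧ m0 τ ≤ m0 0 * Real.exp (-(θ * τ)) +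
        ∫ u in (0 : ℝ)..τ, Real.exp (-(θ * (τ - u))) * |-(wk u) ^ 2 + (wl u) ^ 2 - εb * bk u * wk u|) →
      (∀ τ ∈ Icc 0 T, 0 ≤ m1 τ ∧ m1 τ ≤ m1 0 * Real.exp (-(θ * τ)) +
        ∫ u in (0 : ℝ)..τ, Real.exp (-(θ * (τ - u))) * |wk u * (bk u - br u) + εb * (bk u) ^ 2|) →
      (∀ τ ∈ Icc 0 T, |wl τ| ≤ ω) → (∀ τ ∈ Icc 0 T, -(9 / 20) ≤ br τ ∧ br τ ≤ 9 / 10) →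
      -(2 / 5) ≤ bk 0 → bk 0 ≤ 3 / 10 → |wk 0| ≤ ω / 2 → m0 0 ≤ μ → m1 0 ≤ μ →
      ∀ τ ∈ Icc 0 T, -(9 / 20) ≤ bk τ ∧ bk τ ≤ 7 / 20 ∧ |wk τ| ≤ ω ∧
        |bk τ - bk 0 * Real.exp (-τ)| ≤ 1 / 20 ∧
        m0 τ ≤ μ * Real.exp (-(θ * τ)) + 3 * ω ^ 2 / θ ∧ m1 τ ≤ μ * Real.exp (-(θ * τ)) + 3 * ω / θ := by
  intro bk wk m0 m1 wl br e0 e1 θ η εb ω μ T hθ hθ1 hη hεb hεω hω1 hμ _ hημω hηθ hT hbk hwk _ _ hwl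
    hbr _ _ hdb hdw he0 he1 hm0 hm1 hwlω hbrI hb0l hb0u hw0 hm00 hm10 τ hτ
  obtain ⟨h1, h2, h3, h4, h5, h6⟩ := trailPair_general (L := 1) zero_le_one (by norm_num) hθ hθ1
    hη hεb hεω hω1 hμ hημω hηθ hT hbk hwk hwl hbr hdb hdw he0 he1 hm0 hm1
    (fun t ht => by rw [one_mul]; exact hwlω t ht)
    (fun t ht => ⟨by linarith [(hbrI t ht).1], (hbrI t ht).2⟩) hb0l hb0u hw0 hm00 hm10 τ hτ
  refine ⟨h1, h2, h3, h4, ?_, h6⟩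
  have h7 : ((1 : ℝ) ^ 2 + 2) * ω ^ 2 / θ = 3 * ω ^ 2 / θ := by norm_num
  rw [h7] at h5
  exact h5

end Summit.NavierStokesRegularity.NavierStokesRegularity.Theorems.PerpetualPumpAveragedTypeIBlowup

end
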